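import Summits.AtomisticToContinuum.BoseEinsteinCondensation.Theorems.BoxCountShadowCountParity
import HarnessLib

/-!
# BoxCountShadowOwnCount · part 1 (objects + Kernels A/B) — lens-6 carving #5 (gen 37)

Cell `decomp-a2c`, lens 6, conjunct `BoseEinsteinCondensation`, box line (stmt-AtomisticToContinuum-27506);
first half of the landing split (full story, pieces OCS_h/USR_h/USR^e_h, kernels: `BoxCountShadowOwnCount.lean`):

* §7.2 the objects: the own-count insertion ratio `ownRatio`, the own-count (range-0 Markov) defect
  `ownCountDefect = Σ'_m Σ_B ( (P̄(m)·r_B(m_B) ∸ Q(B,m)) + (Q(B,m) ∸ P̄(m)·r_B(m_B)) )`, and the unit-step bad mass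
  `unitStepBadMass`;
* §7.3 KERNEL A (pointwise trichotomy per `(m, B)`, then two summations; no chaining across cells, hence no
  `c^K` loss): `(t/2)^{1/2} ≤ countAffinity + (t/2)^{1/2}·(K⁻³·badMass_t + (2/t)·ownCountDefect)`
  (`countAffinity_ge_of_ownCount`);
* §7.4 KERNEL B (Cauchy–Schwarz split good/bad of the one-cell count affinity):
  `cellCountAffinity ≤ (K⁻³·goodMass_t)^{1/2} + t^{1/2}`, `K⁻³(goodMass_t + badMass_t) = 1`
  (`cellCountAffinity_le_of_unitStep`, `goodMass_add_badMass`).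

decomp-a2c lens-6 g37 (critic row 547: banked as DOOR #2 of the 27506 leaf line). No instances/notation/sorry.
-/

open MeasureTheory Filter Set
open scoped ENNReal NNReal BigOperators

namespace Summit.AtomisticToContinuum.BoseEinsteinCondensation.Theorems.BoxCountShadow

open Literature.MathematicalPhysics.QuantumManyBody.BoseGas
open Summit.AtomisticToContinuum.BoseEinsteinCondensation.Theorems.BoxLatticeFSum
open Summit.AtomisticToContinuum.BoseEinsteinCondensation.Theorems.BoxLabelAffinity
open Summit.AtomisticToContinuum.BoseEinsteinCondensation.Theorems.BoxHorizonAffinity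

variable {n : ℕ}


/-! ### §7.1  Two `ℝ≥0∞` square-root identities -/

/-- `a^{1/2} · a^{1/2} = a`. [folklore] -/
private theorem rpow_half_mul_rpow_half (a : ℝ≥0∞) : a ^ (1 / 2 : ℝ) * a ^ (1 / 2 : ℝ) = a := by
  rw [← ENNReal.rpow_add_of_nonneg (1 / 2 : ℝ) (1 / 2 : ℝ) (by norm_num) (by norm_num)]; norm_num

/-- `(a²)^{1/2} = a`. [folklore] -/
private theorem sq_rpow_half_eq (a : ℝ≥0∞) : (a ^ 2) ^ (1 / 2 : ℝ) = a := by
  rw [← ENNReal.rpow_two, ← ENNReal.rpow_mul]; norm_num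

/-! ### §7.2  The objects: own-count insertion ratio, own-count (range-0 Markov) defect, unit-step bad mass -/

/-- **Own-count insertion ratio** `G_B(j) = Q_B(j)/P̄_B(j) = P(x₁ ∈ B | n_B(Y) = j)`: the probability that the
inserted particle lies in cell `B` given ONLY the number `j` of other particles in `B` (`ℝ≥0∞` division; `0/0 = 0`).
For a symmetric state `= (j+1)p_B(j+1) / ((j+1)p_B(j+1) + (N−j)p_B(j))`, `p_B` = law of the full count of `B`.
NEW OBJECT of gen 37. [folklore] -/
noncomputable def ownRatio (L : ℝ) (K : ℕ) (Φ : Config (n + 1) → ℝ) (B : SubIdx K) (j : ℕ) : ℝ≥0∞ :=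
  cellMass L K Φ B j / cellSlice L K Φ B j

/-- **Own-count (range-0 Markov) defect** `Σ_m Σ_B |Q(B,m) − P̄(m)·G_B(m_B)|` (symmetrised truncated differences):
the `P̄`-averaged total-variation distance between the law of the inserted particle's cell GIVEN THE WHOLE COUNT
FIELD `m` and the law built from each cell's OWN count only.  Vanishes iff, under `|Φ|²`, the cell of particle 1 is
conditionally independent of the other cells' counts given its own cell's count.  NEW OBJECT of gen 37. [folklore] -/
noncomputable def ownCountDefect (L : ℝ) (K : ℕ) (Φ : Config (n + 1) → ℝ) : ℝ≥0∞ :=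
  ∑' m : SubIdx K → ℕ, ∑ B : SubIdx K,
    ((fibreSlice L K Φ m * ownRatio L K Φ B (m B) - fibreMass L K Φ B m) +
      (fibreMass L K Φ B m - fibreSlice L K Φ m * ownRatio L K Φ B (m B)))

/-- **Unit-step bad mass** at level `t`: `Σ_B Σ_j P̄_B(j)·1[Q_B(j) < t·K⁻³·P̄_B(j)]` — the total `P̄_B`-mass of the
(cell, own-count) pairs at which the one-cell insertion ratio falls below `t K⁻³`.  A functional of the `K³`
ONE-CELL count laws separately (bounded-scale object). NEW OBJECT of gen 37. [folklore] -/
noncomputable def unitStepBadMass (L : ℝ) (K : ℕ) (Φ : Config (n + 1) → ℝ) (t : ℝ≥0∞) : ℝ≥0∞ :=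
  ∑ B : SubIdx K, ∑' j : ℕ,
    {j : ℕ | cellMass L K Φ B j < t * blockWeight K ^ 2 * cellSlice L K Φ B j}.indicator (cellSlice L K Φ B) j

/-! ### §7.3  The abstract inequality -/

/-- **Pointwise trichotomy** behind the kernel: with `P = P̄(m)`, `Q = Q(B,m)`, `S = P̄_B(m_B)`, `C = Q_B(m_B)`,
`w = K^{-3/2}`: either `Q ≥ (t/2)w²P` (the cell contributes `(t/2)^{1/2}w²P` to the count affinity), or the
own-count ratio is bad (`C < t w² S`), or the Markov defect at `(m,B)` is `≥ (t/2)w²P`. [folklore] -/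
theorem ownCount_pointwise (P Q S C w t : ℝ≥0∞) (hPS : P ≤ S) (hS : S ≠ ∞) (ht0 : t ≠ 0) (ht : t ≠ ∞) :
    (t / 2) ^ (1 / 2 : ℝ) * (w ^ 2 * P) ≤
      P ^ (1 / 2 : ℝ) * (w * Q ^ (1 / 2 : ℝ)) +
        (if C < t * w ^ 2 * S then (t / 2) ^ (1 / 2 : ℝ) * (w ^ 2 * P) else 0) +
        (t / 2) ^ (1 / 2 : ℝ) * (2 / t) * (P * (C / S) - Q) := by
  by_cases hP : P = 0
  · simp [hP]
  have hS0 : S ≠ 0 := fun h => hP (le_antisymm (h ▸ hPS) bot_le)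
  by_cases ha : t / 2 * (w ^ 2 * P) ≤ Q
  · have h1 : (t / 2 * (w ^ 2 * P)) ^ (1 / 2 : ℝ) ≤ Q ^ (1 / 2 : ℝ) :=
      ENNReal.rpow_le_rpow ha (by norm_num)
    have h2 : (t / 2 * (w ^ 2 * P)) ^ (1 / 2 : ℝ) = (t / 2) ^ (1 / 2 : ℝ) * (w * P ^ (1 / 2 : ℝ)) := by
      rw [ENNReal.mul_rpow_of_nonneg _ _ (by norm_num : (0 : ℝ) ≤ 1 / 2),
        ENNReal.mul_rpow_of_nonneg _ _ (by norm_num : (0 : ℝ) ≤ 1 / 2), sq_rpow_half_eq]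
    have h3 : (t / 2) ^ (1 / 2 : ℝ) * (w ^ 2 * P) =
        P ^ (1 / 2 : ℝ) * (w * ((t / 2) ^ (1 / 2 : ℝ) * (w * P ^ (1 / 2 : ℝ)))) := by
      conv_lhs => rw [← rpow_half_mul_rpow_half P]
      ring
    refine le_add_right (le_add_right ?_)
    rw [h3, ← h2]
    exact mul_le_mul' le_rfl (mul_le_mul' le_rfl h1)
  · rw [not_le] at ha
    by_cases hb : C < t * w ^ 2 * S
    · rw [if_pos hb]
      exact le_add_right le_add_self
    · rw [if_neg hb, add_zero]
      rw [not_lt] at hb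
      have hG : t * w ^ 2 ≤ C / S := by
        rw [ENNReal.le_div_iff_mul_le (Or.inl hS0) (Or.inl hS)]; exact hb
      have h3 : t / 2 * (w ^ 2 * P) + t / 2 * (w ^ 2 * P) ≤ P * (C / S) := by
        calc t / 2 * (w ^ 2 * P) + t / 2 * (w ^ 2 * P) = t * w ^ 2 * P := by
              rw [← add_mul, ENNReal.add_halves, mul_assoc]
          _ ≤ C / S * P := mul_le_mul' hG le_rfl
          _ = P * (C / S) := mul_comm _ _
      have h4 : t / 2 * (w ^ 2 * P) ≤ P * (C / S) - Q :=
        ENNReal.le_sub_of_add_le_left ha.ne_top ((add_le_add ha.le le_rfl).trans h3)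
      have h5 : (2 / t) * (t / 2) = 1 := by
        calc (2 / t) * (t / 2) = 2 * (t⁻¹ * t) * 2⁻¹ := by rw [div_eq_mul_inv, div_eq_mul_inv]; ring
          _ = 1 := by
              rw [ENNReal.inv_mul_cancel ht0 ht, mul_one, ENNReal.mul_inv_cancel (by norm_num) (by norm_num)]
      have h6 : (t / 2) ^ (1 / 2 : ℝ) * (2 / t) * (t / 2 * (w ^ 2 * P)) =
          (t / 2) ^ (1 / 2 : ℝ) * (w ^ 2 * P) := by
        calc (t / 2) ^ (1 / 2 : ℝ) * (2 / t) * (t / 2 * (w ^ 2 * P))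
            = (t / 2) ^ (1 / 2 : ℝ) * ((2 / t) * (t / 2)) * (w ^ 2 * P) := by ring
          _ = (t / 2) ^ (1 / 2 : ℝ) * (w ^ 2 * P) := by rw [h5, mul_one]
      calc (t / 2) ^ (1 / 2 : ℝ) * (w ^ 2 * P)
          = (t / 2) ^ (1 / 2 : ℝ) * (2 / t) * (t / 2 * (w ^ 2 * P)) := h6.symm
        _ ≤ (t / 2) ^ (1 / 2 : ℝ) * (2 / t) * (P * (C / S) - Q) := mul_le_mul' le_rfl h4
        _ ≤ _ := le_add_self

/-- `P̄_B(j) = Σ_{m : m_B = j} P̄(m)`: the one-cell count law is the push-forward of the count-field law along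
`m ↦ m_B` (fibre regrouping, as a `tsum` of an indicator). [folklore] -/
theorem cellSlice_eq_tsum_indicator (L : ℝ) (K : ℕ) (Φ : Config (n + 1) → ℝ) (B : SubIdx K) (j : ℕ) :
    cellSlice L K Φ B j =
      ∑' m : SubIdx K → ℕ, ((fun m : SubIdx K → ℕ => m B) ⁻¹' {j}).indicator (fibreSlice L K Φ) m := by
  have hπ : MeasurableSet ((fun m : SubIdx K → ℕ => m B) ⁻¹' ({j} : Set ℕ)) :=
    (measurable_of_countable _) (measurableSet_singleton j)
  unfold cellSlice fibreSlice
  rw [← setLIntegral_count_fibre volume (measurable_countVec (L / (K : ℝ)) K)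
    (fun m : SubIdx K → ℕ => m B) (sliceSq Φ) j, ← lintegral_indicator hπ, lintegral_count]

/-- **Regrouping along the own count**: `Σ_m P̄(m) f(m_B) = Σ_j P̄_B(j) f(j)`. [folklore] -/
theorem tsum_fibreSlice_mul_apply (L : ℝ) (K : ℕ) (Φ : Config (n + 1) → ℝ) (B : SubIdx K) (f : ℕ → ℝ≥0∞) :
    ∑' m : SubIdx K → ℕ, fibreSlice L K Φ m * f (m B) = ∑' j : ℕ, cellSlice L K Φ B j * f j := by
  have hrhs : ∀ j : ℕ, cellSlice L K Φ B j * f j =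
      ∑' m : SubIdx K → ℕ, ((fun m : SubIdx K → ℕ => m B) ⁻¹' {j}).indicator (fibreSlice L K Φ) m * f j := by
    intro j
    rw [cellSlice_eq_tsum_indicator, ENNReal.tsum_mul_right]
  rw [tsum_congr hrhs, ENNReal.tsum_comm]
  refine tsum_congr fun m => ?_
  have hterm : ∀ j : ℕ, ((fun m : SubIdx K → ℕ => m B) ⁻¹' {j}).indicator (fibreSlice L K Φ) m * f j =
      if j = m B then fibreSlice L K Φ m * f (m B) else 0 := by
    intro j
    by_cases h : j = m B
    · subst h
      rw [if_pos rfl, Set.indicator_of_mem (by simp)]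
    · rw [if_neg h, Set.indicator_of_notMem, zero_mul]
      simpa [Set.mem_preimage, Set.mem_singleton_iff, eq_comm] using h
  rw [tsum_congr hterm, tsum_ite_eq]

/-- `P̄(m) ≤ P̄_B(m_B)` (one term of the regrouped sum). [folklore] -/
theorem fibreSlice_le_cellSlice (L : ℝ) (K : ℕ) (Φ : Config (n + 1) → ℝ) (B : SubIdx K) (m : SubIdx K → ℕ) :
    fibreSlice L K Φ m ≤ cellSlice L K Φ B (m B) := by
  rw [cellSlice_eq_tsum_indicator]
  refine le_trans (le_of_eq ?_) (ENNReal.le_tsum m)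
  rw [Set.indicator_of_mem (by simp)]

/-- `P̄_B(j) ≤ 1` for a normalised amplitude. [folklore] -/
theorem cellSlice_le_one {L : ℝ} {K : ℕ} {Φ : Config (n + 1) → ℝ}
    (hΦ1 : ∫⁻ Y : Config n, ∫⁻ x, ENNReal.ofReal (Φ (Matrix.vecCons x Y)) ^ 2 = 1) (B : SubIdx K) (j : ℕ) :
    cellSlice L K Φ B j ≤ 1 := by
  have hT : Measurable ((fun m : SubIdx K → ℕ => m B) ∘ countVec (n := n) (L / (K : ℝ)) K) :=
    (measurable_pi_apply B).comp (measurable_countVec (L / (K : ℝ)) K)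
  have hint : (∫⁻ Y : Config n, sliceSq Φ Y) = 1 := hΦ1
  calc cellSlice L K Φ B j ≤ ∑' j, cellSlice L K Φ B j := ENNReal.le_tsum j
    _ = ∫⁻ Y : Config n, sliceSq Φ Y := by
        unfold cellSlice
        rw [← lintegral_eq_tsum_fibre volume hT (sliceSq Φ)]
    _ = 1 := hint

/-- **THE GEN-37 INEQUALITY** (every normalised measurable `Φ`, every `K`, every level `t ∈ (0,∞)`):
`(t/2)^{1/2} ≤ countAffinity + (t/2)^{1/2}·(K⁻³·unitStepBadMass t + (2/t)·ownCountDefect)`.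
Chain-free: each `(m,B)` is treated on its own by `ownCount_pointwise`, then summed. [folklore] -/
theorem countAffinity_ge_of_ownCount {L : ℝ} {K : ℕ} (hK : 0 < K) {Φ : Config (n + 1) → ℝ}
    (hΦ1 : ∫⁻ Y : Config n, ∫⁻ x, ENNReal.ofReal (Φ (Matrix.vecCons x Y)) ^ 2 = 1)
    {t : ℝ≥0∞} (ht0 : t ≠ 0) (ht : t ≠ ∞) :
    (t / 2) ^ (1 / 2 : ℝ) ≤ countAffinity L K Φ +
      ((t / 2) ^ (1 / 2 : ℝ) * (blockWeight K ^ 2 * unitStepBadMass L K Φ t) +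
        (t / 2) ^ (1 / 2 : ℝ) * (2 / t) * ownCountDefect L K Φ) := by
  -- abbreviations
  set s : ℝ≥0∞ := (t / 2) ^ (1 / 2 : ℝ) with hsdef
  set w : ℝ≥0∞ := blockWeight K with hwdef
  set P : (SubIdx K → ℕ) → ℝ≥0∞ := fibreSlice L K Φ with hPdef
  set Q : SubIdx K → (SubIdx K → ℕ) → ℝ≥0∞ := fibreMass L K Φ with hQdef
  have hint : (∫⁻ Y : Config n, sliceSq Φ Y) = 1 := hΦ1
  have hsum1 : ∑' m, P m = 1 := by rw [hPdef, tsum_fibreSlice]; exact hint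
  -- the bad predicate, cell by cell
  set bad : SubIdx K → Set ℕ :=
    fun B => {j : ℕ | cellMass L K Φ B j < t * w ^ 2 * cellSlice L K Φ B j} with hbaddef
  -- pointwise inequality
  have hpt : ∀ m B, s * (w ^ 2 * P m) ≤
      P m ^ (1 / 2 : ℝ) * (w * Q B m ^ (1 / 2 : ℝ)) +
        (if cellMass L K Φ B (m B) < t * w ^ 2 * cellSlice L K Φ B (m B) then s * (w ^ 2 * P m) else 0) +
        s * (2 / t) * (P m * ownRatio L K Φ B (m B) - Q B m) :=
    fun m B => ownCount_pointwise (P m) (Q B m) (cellSlice L K Φ B (m B)) (cellMass L K Φ B (m B)) w t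
      (fibreSlice_le_cellSlice L K Φ B m) (ne_top_of_le_ne_top ENNReal.one_ne_top (cellSlice_le_one hΦ1 B (m B)))
      ht0 ht
  -- LHS summed
  have hlhs : ∑' m, ∑ B : SubIdx K, s * (w ^ 2 * P m) = s := by
    have h1 : ∀ m, ∑ B : SubIdx K, s * (w ^ 2 * P m) = s * P m := by
      intro m
      rw [← Finset.mul_sum, ← Finset.sum_mul, hwdef, sum_blockWeight_sq hK, one_mul]
    rw [tsum_congr h1, ENNReal.tsum_mul_left, hsum1, mul_one]
  -- T1 summed = countAffinity
  have hT1 : ∑' m, ∑ B : SubIdx K, P m ^ (1 / 2 : ℝ) * (w * Q B m ^ (1 / 2 : ℝ)) = countAffinity L K Φ := by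
    unfold countAffinity
    refine tsum_congr fun m => ?_
    rw [Finset.mul_sum]
  -- T2 summed = s · w² · badMass
  have hT2 : ∑' m, ∑ B : SubIdx K,
      (if cellMass L K Φ B (m B) < t * w ^ 2 * cellSlice L K Φ B (m B) then s * (w ^ 2 * P m) else 0) =
      s * (w ^ 2 * unitStepBadMass L K Φ t) := by
    rw [Summable.tsum_finsetSum (fun _ _ => ENNReal.summable), unitStepBadMass, Finset.mul_sum, Finset.mul_sum]
    refine Finset.sum_congr rfl fun B _ => ?_
    have hite : ∀ m : SubIdx K → ℕ,
        (if cellMass L K Φ B (m B) < t * w ^ 2 * cellSlice L K Φ B (m B) then s * (w ^ 2 * P m) else 0) =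
        P m * (bad B).indicator (fun _ => s * w ^ 2) (m B) := by
      intro m
      by_cases h : cellMass L K Φ B (m B) < t * w ^ 2 * cellSlice L K Φ B (m B)
      · have hm : m B ∈ bad B := h
        rw [if_pos h, Set.indicator_of_mem hm]; ring
      · have hm : m B ∉ bad B := h
        rw [if_neg h, Set.indicator_of_notMem hm, mul_zero]
    rw [tsum_congr hite, tsum_fibreSlice_mul_apply]
    have hj : ∀ j : ℕ, cellSlice L K Φ B j * (bad B).indicator (fun _ => s * w ^ 2) j =
        s * w ^ 2 * (bad B).indicator (cellSlice L K Φ B) j := by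
      intro j
      by_cases h : j ∈ bad B
      · rw [Set.indicator_of_mem h, Set.indicator_of_mem h]; ring
      · rw [Set.indicator_of_notMem h, Set.indicator_of_notMem h, mul_zero, mul_zero]
    rw [tsum_congr hj, ENNReal.tsum_mul_left, ← mul_assoc]
  -- T3 summed ≤ s (2/t) · defect
  have hT3 : ∑' m, ∑ B : SubIdx K, s * (2 / t) * (P m * ownRatio L K Φ B (m B) - Q B m) ≤
      s * (2 / t) * ownCountDefect L K Φ := by
    rw [ownCountDefect, ← ENNReal.tsum_mul_left]
    refine ENNReal.tsum_le_tsum fun m => ?_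
    rw [Finset.mul_sum]
    exact Finset.sum_le_sum fun B _ => mul_le_mul' le_rfl le_self_add
  -- assemble
  calc s = ∑' m, ∑ B : SubIdx K, s * (w ^ 2 * P m) := hlhs.symm
    _ ≤ ∑' m, ∑ B : SubIdx K,
          (P m ^ (1 / 2 : ℝ) * (w * Q B m ^ (1 / 2 : ℝ)) +
            (if cellMass L K Φ B (m B) < t * w ^ 2 * cellSlice L K Φ B (m B) then s * (w ^ 2 * P m) else 0) +
            s * (2 / t) * (P m * ownRatio L K Φ B (m B) - Q B m)) :=
        ENNReal.tsum_le_tsum fun m => Finset.sum_le_sum fun B _ => hpt m B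
    _ = ∑' m, ∑ B : SubIdx K, P m ^ (1 / 2 : ℝ) * (w * Q B m ^ (1 / 2 : ℝ)) +
          (∑' m, ∑ B : SubIdx K,
            (if cellMass L K Φ B (m B) < t * w ^ 2 * cellSlice L K Φ B (m B) then s * (w ^ 2 * P m) else 0) +
          ∑' m, ∑ B : SubIdx K, s * (2 / t) * (P m * ownRatio L K Φ B (m B) - Q B m)) := by
        rw [← ENNReal.tsum_add, ← ENNReal.tsum_add]
        refine tsum_congr fun m => ?_
        rw [← Finset.sum_add_distrib, ← Finset.sum_add_distrib]
        refine Finset.sum_congr rfl fun B _ => ?_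
        rw [add_assoc]
    _ ≤ countAffinity L K Φ + (s * (w ^ 2 * unitStepBadMass L K Φ t) + s * (2 / t) * ownCountDefect L K Φ) := by
        rw [hT1, hT2]
        exact add_le_add le_rfl (add_le_add le_rfl hT3)

/-! ### §7.4  Kernel B: the Cauchy–Schwarz split of the one-cell count affinity -/

/-- `(a^{1/2})² = a`. [folklore] -/
private theorem rpow_half_pow_two (a : ℝ≥0∞) : (a ^ (1 / 2 : ℝ)) ^ 2 = a := by
  rw [← ENNReal.rpow_two, ← ENNReal.rpow_mul]; norm_num

/-- **Unit-step good mass** at level `t`: `Σ_B Σ_j P̄_B(j)·1[Q_B(j) ≥ t·K⁻³·P̄_B(j)]`, the complement of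
`unitStepBadMass`. [folklore] -/
noncomputable def unitStepGoodMass (L : ℝ) (K : ℕ) (Φ : Config (n + 1) → ℝ) (t : ℝ≥0∞) : ℝ≥0∞ :=
  ∑ B : SubIdx K, ∑' j : ℕ,
    ({j : ℕ | cellMass L K Φ B j < t * blockWeight K ^ 2 * cellSlice L K Φ B j}ᶜ).indicator (cellSlice L K Φ B) j

/-- `K⁻³·(goodMass + badMass) = 1` for a normalised amplitude (each one-cell count law has mass `1`, and
`K⁻³·#cells = 1`). [folklore] -/
theorem goodMass_add_badMass {L : ℝ} {K : ℕ} (hK : 0 < K) {Φ : Config (n + 1) → ℝ}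
    (hΦ1 : ∫⁻ Y : Config n, ∫⁻ x, ENNReal.ofReal (Φ (Matrix.vecCons x Y)) ^ 2 = 1) (t : ℝ≥0∞) :
    blockWeight K ^ 2 * unitStepGoodMass L K Φ t + blockWeight K ^ 2 * unitStepBadMass L K Φ t = 1 := by
  have hT : ∀ B : SubIdx K,
      Measurable ((fun m : SubIdx K → ℕ => m B) ∘ countVec (n := n) (L / (K : ℝ)) K) :=
    fun B => (measurable_pi_apply B).comp (measurable_countVec (L / (K : ℝ)) K)
  have hS : ∀ B : SubIdx K, ∑' j : ℕ, cellSlice L K Φ B j = 1 := by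
    intro B
    unfold cellSlice
    rw [← lintegral_eq_tsum_fibre volume (hT B) (sliceSq Φ)]
    exact hΦ1
  rw [← mul_add, unitStepGoodMass, unitStepBadMass, ← Finset.sum_add_distrib]
  have hB : ∀ B : SubIdx K,
      ∑' j : ℕ, ({j : ℕ | cellMass L K Φ B j < t * blockWeight K ^ 2 * cellSlice L K Φ B j}ᶜ).indicator
          (cellSlice L K Φ B) j +
        ∑' j : ℕ, ({j : ℕ | cellMass L K Φ B j < t * blockWeight K ^ 2 * cellSlice L K Φ B j}).indicator
          (cellSlice L K Φ B) j = 1 := by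
    intro B
    rw [← ENNReal.tsum_add, ← hS B]
    refine tsum_congr fun j => ?_
    by_cases h : j ∈ {j : ℕ | cellMass L K Φ B j < t * blockWeight K ^ 2 * cellSlice L K Φ B j}
    · rw [Set.indicator_of_mem h, Set.indicator_of_notMem (by simpa [Set.mem_compl_iff] using h), zero_add]
    · rw [Set.indicator_of_notMem h, Set.indicator_of_mem (show j ∈ _ᶜ from h), add_zero]
  rw [Finset.sum_congr rfl fun B _ => hB B, Finset.mul_sum]
  simp_rw [mul_one]
  exact sum_blockWeight_sq hK

/-- **KERNEL B** (every normalised measurable `Φ`, every `K ≥ 1`, `L > 0`, every level `t`):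
`cellCountAffinity ≤ (K⁻³·goodMass_t)^{1/2} + t^{1/2}` — Cauchy–Schwarz on the good (cell, own-count) pairs, the
defining inequality `Q_B(j) < tK⁻³P̄_B(j)` on the bad ones. [folklore] -/
theorem cellCountAffinity_le_of_unitStep {L : ℝ} {K : ℕ} (hL : 0 < L) (hK : 0 < K) {Φ : Config (n + 1) → ℝ}
    (hΦm : Measurable Φ) (hΦ1 : ∫⁻ Y : Config n, ∫⁻ x, ENNReal.ofReal (Φ (Matrix.vecCons x Y)) ^ 2 = 1)
    (t : ℝ≥0∞) :
    cellCountAffinity L K Φ ≤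
      (blockWeight K ^ 2 * unitStepGoodMass L K Φ t) ^ (1 / 2 : ℝ) + t ^ (1 / 2 : ℝ) := by
  set w : ℝ≥0∞ := blockWeight K with hwdef
  set S : SubIdx K → ℕ → ℝ≥0∞ := cellSlice L K Φ with hSdef
  set C : SubIdx K → ℕ → ℝ≥0∞ := cellMass L K Φ with hCdef
  set bad : SubIdx K → Set ℕ := fun B => {j : ℕ | C B j < t * w ^ 2 * S B j} with hbaddef
  have hT : ∀ B : SubIdx K,
      Measurable ((fun m : SubIdx K → ℕ => m B) ∘ countVec (n := n) (L / (K : ℝ)) K) :=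
    fun B => (measurable_pi_apply B).comp (measurable_countVec (L / (K : ℝ)) K)
  have hS1 : ∀ B : SubIdx K, ∑' j : ℕ, S B j = 1 := by
    intro B
    rw [hSdef]; unfold cellSlice
    rw [← lintegral_eq_tsum_fibre volume (hT B) (sliceSq Φ)]
    exact hΦ1
  have hM : ∀ B : SubIdx K, ∑' j : ℕ, C B j = ∫⁻ Y, blockMass L K Φ B Y := by
    intro B
    rw [hCdef]; unfold cellMass
    rw [← lintegral_eq_tsum_fibre volume (hT B) (blockMass L K Φ B)]
  have hint : (∫⁻ Y : Config n, sliceSq Φ Y) = 1 := hΦ1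
  have hsumC : ∑ B : SubIdx K, ∫⁻ Y, blockMass L K Φ B Y ≤ 1 := by
    rw [← lintegral_finsetSum _ fun B _ => measurable_blockMass L K hΦm B, ← hint]
    exact lintegral_mono fun Y => sum_blockMass_le_sliceSq hL hK hΦm Y
  -- pointwise split of one term
  have hpt : ∀ B j, S B j ^ (1 / 2 : ℝ) * C B j ^ (1 / 2 : ℝ) ≤
      ((bad B)ᶜ.indicator (S B) j) ^ (1 / 2 : ℝ) * C B j ^ (1 / 2 : ℝ) + t ^ (1 / 2 : ℝ) * (w * S B j) := by
    intro B j
    by_cases h : j ∈ bad B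
    · have hlt : C B j < t * w ^ 2 * S B j := h
      have h1 : C B j ^ (1 / 2 : ℝ) ≤ (t * w ^ 2 * S B j) ^ (1 / 2 : ℝ) :=
        ENNReal.rpow_le_rpow hlt.le (by norm_num)
      have h2 : (t * w ^ 2 * S B j) ^ (1 / 2 : ℝ) = t ^ (1 / 2 : ℝ) * w * S B j ^ (1 / 2 : ℝ) := by
        rw [ENNReal.mul_rpow_of_nonneg _ _ (by norm_num : (0 : ℝ) ≤ 1 / 2),
          ENNReal.mul_rpow_of_nonneg _ _ (by norm_num : (0 : ℝ) ≤ 1 / 2), sq_rpow_half_eq]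
      refine le_add_left ?_
      calc S B j ^ (1 / 2 : ℝ) * C B j ^ (1 / 2 : ℝ)
          ≤ S B j ^ (1 / 2 : ℝ) * (t ^ (1 / 2 : ℝ) * w * S B j ^ (1 / 2 : ℝ)) := by
            rw [← h2]; exact mul_le_mul' le_rfl h1
        _ = t ^ (1 / 2 : ℝ) * (w * S B j) := by
            conv_rhs => rw [← rpow_half_mul_rpow_half (S B j)]
            ring
    · rw [Set.indicator_of_mem (show j ∈ (bad B)ᶜ from h)]
      exact le_self_add
  -- sum
  have hstep1 : cellCountAffinity L K Φ ≤
      ∑ B : SubIdx K, w * ((∑' j, (bad B)ᶜ.indicator (S B) j) ^ (1 / 2 : ℝ) * (∑' j, C B j) ^ (1 / 2 : ℝ)) +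
        ∑ B : SubIdx K, w * (t ^ (1 / 2 : ℝ) * w) := by
    unfold cellCountAffinity
    rw [← Finset.sum_add_distrib]
    refine Finset.sum_le_sum fun B _ => ?_
    rw [← mul_add]
    refine mul_le_mul' le_rfl ?_
    calc ∑' j, S B j ^ (1 / 2 : ℝ) * C B j ^ (1 / 2 : ℝ)
        ≤ ∑' j, (((bad B)ᶜ.indicator (S B) j) ^ (1 / 2 : ℝ) * C B j ^ (1 / 2 : ℝ) +
            t ^ (1 / 2 : ℝ) * (w * S B j)) := ENNReal.tsum_le_tsum fun j => hpt B j
      _ = ∑' j, ((bad B)ᶜ.indicator (S B) j) ^ (1 / 2 : ℝ) * C B j ^ (1 / 2 : ℝ) +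
            ∑' j, t ^ (1 / 2 : ℝ) * (w * S B j) := ENNReal.tsum_add
      _ ≤ (∑' j, (bad B)ᶜ.indicator (S B) j) ^ (1 / 2 : ℝ) * (∑' j, C B j) ^ (1 / 2 : ℝ) +
            t ^ (1 / 2 : ℝ) * w := by
          refine add_le_add (tsum_rpow_half_mul_le _ _) (le_of_eq ?_)
          rw [ENNReal.tsum_mul_left, ENNReal.tsum_mul_left, hS1 B, mul_one]
  have hbadsum : ∑ B : SubIdx K, w * (t ^ (1 / 2 : ℝ) * w) = t ^ (1 / 2 : ℝ) := by
    have : ∀ B : SubIdx K, w * (t ^ (1 / 2 : ℝ) * w) = t ^ (1 / 2 : ℝ) * w ^ 2 := fun B => by ring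
    rw [Finset.sum_congr rfl fun B _ => this B, ← Finset.mul_sum, hwdef, sum_blockWeight_sq hK, mul_one]
  have hgood : ∑ B : SubIdx K, w * ((∑' j, (bad B)ᶜ.indicator (S B) j) ^ (1 / 2 : ℝ) *
      (∑' j, C B j) ^ (1 / 2 : ℝ)) ≤ (w ^ 2 * unitStepGoodMass L K Φ t) ^ (1 / 2 : ℝ) := by
    have hrw : ∀ B : SubIdx K, w * ((∑' j, (bad B)ᶜ.indicator (S B) j) ^ (1 / 2 : ℝ) *
        (∑' j, C B j) ^ (1 / 2 : ℝ)) =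
        (w * (∑' j, (bad B)ᶜ.indicator (S B) j) ^ (1 / 2 : ℝ)) * (∑' j, C B j) ^ (1 / 2 : ℝ) :=
      fun B => by ring
    rw [Finset.sum_congr rfl fun B _ => hrw B]
    refine (sum_mul_rpow_half_le _ _ _).trans ?_
    have hsq : ∀ B : SubIdx K, (w * (∑' j, (bad B)ᶜ.indicator (S B) j) ^ (1 / 2 : ℝ)) ^ 2 =
        w ^ 2 * ∑' j, (bad B)ᶜ.indicator (S B) j := fun B => by rw [mul_pow, rpow_half_pow_two]
    rw [Finset.sum_congr rfl fun B _ => hsq B, ← Finset.mul_sum]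
    calc (w ^ 2 * ∑ B : SubIdx K, ∑' j, (bad B)ᶜ.indicator (S B) j) ^ (1 / 2 : ℝ) *
          (∑ B : SubIdx K, ∑' j, C B j) ^ (1 / 2 : ℝ)
        ≤ (w ^ 2 * unitStepGoodMass L K Φ t) ^ (1 / 2 : ℝ) * (1 : ℝ≥0∞) ^ (1 / 2 : ℝ) := by
          refine mul_le_mul' le_rfl (ENNReal.rpow_le_rpow ?_ (by norm_num))
          calc ∑ B : SubIdx K, ∑' j, C B j = ∑ B : SubIdx K, ∫⁻ Y, blockMass L K Φ B Y :=
                Finset.sum_congr rfl fun B _ => hM B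
            _ ≤ 1 := hsumC
      _ = (w ^ 2 * unitStepGoodMass L K Φ t) ^ (1 / 2 : ℝ) := by rw [ENNReal.one_rpow, mul_one]
  calc cellCountAffinity L K Φ ≤ _ := hstep1
    _ ≤ (w ^ 2 * unitStepGoodMass L K Φ t) ^ (1 / 2 : ℝ) + t ^ (1 / 2 : ℝ) := by
        rw [hbadsum]; exact add_le_add hgood le_rfl


end Summit.AtomisticToContinuum.BoseEinsteinCondensation.Theorems.BoxCountShadow
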